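import Summits.QuantumFields.BalabanUV.Beta.GAN24.WardResidualRotatedVertex
import Summits.QuantumFields.BalabanUV.Beta.GAN24.LatticeFreeze

/-!
# `BalabanUV.Beta.GAN24.WardResidualRotatedVertexDipole` — binder row G-an2-4 ∕ (CONV-C), CT-W route «WC-TL» → «QR-LL», the OWNER gan24-p1 g26's CHARGE AUDIT,
# σ-piece (α): **THE FIRST SLOT-MOMENT (SLOT-DIPOLE) OF THE ROTATED-VERTEX LETTER IN CLOSED FORM** — the OWNER's W15 ask on `WardResidualRotatedVertex`
# (journal l.40483: «display also `Σ_{y′} (y′ − y)_λ · [charge of (α) at slot (ν,y′)]` in closed form — the first moment of ONE coarse column of `G_{j+1}` × the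
# stencils' channel totals»; = idea-1 g35's `WARD8-GAN24.md` (4.9) `π^{RV}`; road-P2 chair `b2b-balaban-gan24-p2`, gen 38)

NOT IN PRINT; OUR BOOKKEEPING ([folklore] finite-support bookkeeping of two `tsum`s + one dominated-convergence summability over the tree's `l1` calculus and
p1's `LatticeFreeze.mul_exp_neg_le`, BY NAME; 0 `def`, 0 cited fact, 0 `def … : Prop`, 0 sorry).  HONEST FRAMING (cell contract, verbatim): «discharging `BetaPertH`
makes Bałaban's UV stability UNCONDITIONAL — a real constructive-QFT result; it is NOT the continuum limit and NOT the Clay problem.»  HONEST DEPENDENCY (verbatim):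
«continuum YM on T⁴ ⇐ BetaPertH ∧ nine spine estimates (0/9 proved); BetaPertH ⇐ (D1) ∧ (D4) ∧ CAP+tail; G-an2-4 gates asym, D1 and NE2/3/4.»

WHAT.  `WardResidualRotatedVertex.hasSum_prod_rotatedVertex_comb` displays the live charge of (α) = `½ • dM([G_{j+1}, X_y]) S_{j+1} M1_{j+1}` at slot `(ν, y′)`, channel
`(a, b)`, as `V(y′) = ½·[Σ_κ Σ'_u colH G ν y′ κ u·(½𝟙[y′=y] − ½𝟙[blk u = y])·Z_S(κ,u) + Σ_ρ′ Σ'_w colM G ν y′ ρ′ w·(½𝟙[y′=y] − ½𝟙[w=y])·Z_M(ρ′,w)]`.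
* §1 **`slotMoment_term_eq`** (ANY kernel `G`, ANY charge tables `Z_S`, `Z_M` — pure finite-support bookkeeping): weighted by the slot offset `(y′ − y)_λ` the
  DIAGONAL-slot term carries no moment and the two `tsum`s collapse to the label block:
  `(y′ − y)_λ · V(y′) = −¼·(y′ − y)_λ·[Σ_κ Σ_{v∈box} colH G ν y′ κ (Lc•y + v)·Z_S(κ, Lc•y + v) + Σ_ρ′ colM G ν y′ ρ′ y·Z_M(ρ′, y)]`.
* §2 `summable_slotMoment_of_decay` ([folklore]): the first slot-moment of anything dominated by `C·e^{−δ|u − N•y′|₁}` is summable over the coarse slot `y′`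
  (`|(y′−y)_λ| ≤ |u − N•y′|₁ + |u − N•y|₁`, `t·e^{−δt} ≤ (2∕δ)·e^{−(δ∕2)t}`); instances `summable_slotMoment_colH ∕ _colM` for a decaying kernel.
* §3 **`hasSum_slotMoment_rotatedVertex_comb`** — THE SLOT-DIPOLE OF (α) ABOUT THE LABEL BLOCK IN CLOSED FORM (as a `HasSum` over the slot `y′`):
  `Σ_{y′} (y′ − y)_λ·V(y′) = −¼·[Σ_κ Σ_{v∈box} (Σ'_{y′} (y′ − y)_λ·colH G_{j+1} Lc ν y′ κ (Lc•y + v))·Z_S(κ, Lc•y + v) + Σ_ρ′ (Σ'_{y′} (y′ − y)_λ·colM G_{j+1} Lc ν y′ ρ′ y)·Z_{M1}(ρ′, y)]`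
  — the FIRST MOMENT OF ONE COARSE COLUMN of `G_{j+1}` (field rows on the label block, multiplier row at the label) against the first-order letters' own pair charges;
  idea-1's `π^{RV}_{ν;λ}` with the label `y` kept (no covariance reduction).  (The OWNER: E15 finds this dipole NONZERO and cancelling against the gauge-read piece (γ)'s —
  the (S) identity of record is «(α)-dipole + (γ)-dipole (+ (β)) = 0»; this file supplies the (α) side, leaf-06 g44's `GaugeReadCharge` currency the (γ) side.)
Asserts NO value of Bałaban's tables; discharges NOTHING of (Q-R) ∕ (LT) ∕ (Q-L) ∕ (C) ∕ «T2Shape» ∕ «T2Drift» ∕ (hW, hWall); NEVER «G-an2-4 closed» as (CONV-C); NOT D1,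
NOT BetaPertH, NOT continuum, NOT Clay.  2026-08-22; no existing file touched.
-/

noncomputable section

open Finset
open scoped BigOperators
open Literature.MathematicalPhysics.QuantumFieldTheory
open Literature.MathematicalPhysics.QuantumFieldTheory.Balaban1983to89
open Literature.MathematicalPhysics.QuantumFieldTheory.Balaban1983to89.Beta
open B12Sec2to5 (l1 l1_nonneg)
open ExpKernelCalculus (Site MKer Decays l1_sub_triangle l1_sub_symm l1_natSmul)
open AffineAveraging (box toSite)
open AveragingContours (blk blk_block off off_mem_box blk_add_off)
open OneStepResolventKernel (Fib)
open OneStepKernelFamily (KInvStep colH abs_colH_le)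
open SecondOrderResponse (colM dM abs_colM_le)
open Summit.QuantumFields.BalabanUV.Beta.BorderedHessian (diagK)
open Summit.QuantumFields.BalabanUV.Beta.ChartConjugation (conjV)
open Summit.QuantumFields.BalabanUV.Beta.AveragingWardRootedStencils (legInd)
open Summit.QuantumFields.BalabanUV.Beta.AxialDressingRooted (coDressKBmAt decays_coDressKBmAt_KInvStep)
open Summit.QuantumFields.BalabanUV.Beta.SpineRooted (SpureRecAt M1At)
open Summit.QuantumFields.BalabanUV.Beta.GAN24.ResolventLegCharges (summable_exp_coarse')
open Summit.QuantumFields.BalabanUV.Beta.GAN24.LatticeFreeze (mul_exp_neg_le)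
open Summit.QuantumFields.BalabanUV.Beta.GAN24.WardResidualRotatedVertex (hasSum_prod_rotatedVertex_comb)

namespace Summit.QuantumFields.BalabanUV.Beta.GAN24.WardResidualRotatedVertexDipole

variable {d : ℕ}

/-! ## §1 Weighted by the slot offset, the diagonal-slot term drops and the two `tsum`s collapse to the label block -/

section Pointwise

variable {Lc : ℕ}

/-- [folklore] A `tsum` over the fine lattice of a function supported on the block `B(y) = {u : blk Lc u = y}` is the finite block sum over `v ∈ box`. -/
theorem tsum_ite_blk_eq (hLc : 1 ≤ Lc) (y : Site (d + 1)) (f : Site (d + 1) → ℝ) :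
    ∑' u : Site (d + 1), (if blk Lc u = y then f u else 0) = ∑ v ∈ box (d + 1) Lc, f ((Lc : ℤ) • y + toSite v) := by
  classical
  have hinj : Set.InjOn (fun v : Fin (d + 1) → ℕ => (Lc : ℤ) • y + toSite v) ↑(box (d + 1) Lc) := fun v _ v' _ h =>
    AxialProjector.toSite_injective (add_left_cancel h)
  rw [tsum_eq_sum (s := (box (d + 1) Lc).image fun v => (Lc : ℤ) • y + toSite v) (fun u hu => ?_), Finset.sum_image hinj]
  · refine Finset.sum_congr rfl fun v hv => ?_
    rw [if_pos (blk_block y hv)]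
  · rw [if_neg]
    intro hb
    refine hu (Finset.mem_image.2 ⟨off Lc u, off_mem_box hLc u, ?_⟩)
    rw [← hb]
    exact blk_add_off hLc u

/-- [folklore] **THE SLOT-WEIGHTED CHARGE TERM OF (α)** (ANY kernel `G`, ANY charge tables `Z_S`, `Z_M`): with the weight `(y′ − y)_λ` the diagonal-slot indicator
`𝟙[y′ = y]` carries no moment, the `u`-sum collapses to the label block and the `w`-sum to the label:
`(y′−y)_λ · ½·[Σ_κ Σ'_u colH G ν y′ κ u·(½𝟙[y′=y] − ½𝟙[blk u = y])·Z_S κ u + Σ_ρ′ Σ'_w colM G ν y′ ρ′ w·(½𝟙[y′=y] − ½𝟙[w=y])·Z_M ρ′ w]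
 = −¼·[Σ_κ Σ_{v∈box} (y′−y)_λ·colH G ν y′ κ (Lc•y+v)·Z_S κ (Lc•y+v) + Σ_ρ′ (y′−y)_λ·colM G ν y′ ρ′ y·Z_M ρ′ y]`. -/
theorem slotMoment_term_eq (hLc : 1 ≤ Lc) (G : MKer (d + 1) (Fib d)) (ZS ZM : Fin (d + 1) → Site (d + 1) → ℝ)
    (y : Site (d + 1)) (ν : Fin (d + 1)) (lam : Fin (d + 1)) (y' : Site (d + 1)) :
    (((y' lam : ℤ) : ℝ) - ((y lam : ℤ) : ℝ)) *
        ((1 / 2 : ℝ) *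
          ((∑ κ : Fin (d + 1), ∑' u : Site (d + 1),
              colH G Lc ν y' κ u * ((if y' = y then (1 / 2 : ℝ) else 0) - (if blk Lc u = y then (1 / 2 : ℝ) else 0)) * ZS κ u)
            + ∑ ρ' : Fin (d + 1), ∑' w : Site (d + 1),
              colM G Lc ν y' ρ' w * ((if y' = y then (1 / 2 : ℝ) else 0) - (if w = y then (1 / 2 : ℝ) else 0)) * ZM ρ' w)) =
      -(1 / 4 : ℝ) *
        ((∑ κ : Fin (d + 1), ∑ v ∈ box (d + 1) Lc,
            (((y' lam : ℤ) : ℝ) - ((y lam : ℤ) : ℝ)) * colH G Lc ν y' κ ((Lc : ℤ) • y + toSite v) * ZS κ ((Lc : ℤ) • y + toSite v))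
          + ∑ ρ' : Fin (d + 1), (((y' lam : ℤ) : ℝ) - ((y lam : ℤ) : ℝ)) * colM G Lc ν y' ρ' y * ZM ρ' y) := by
  classical
  by_cases hy : y' = y
  · subst hy
    simp only [sub_self, zero_mul, Finset.sum_const_zero, add_zero, mul_zero]
  · simp only [if_neg hy, zero_sub]
    have hS : ∀ κ : Fin (d + 1), (∑' u : Site (d + 1), colH G Lc ν y' κ u * (-(if blk Lc u = y then (1 / 2 : ℝ) else 0)) * ZS κ u)
        = -(1 / 2 : ℝ) * ∑ v ∈ box (d + 1) Lc, colH G Lc ν y' κ ((Lc : ℤ) • y + toSite v) * ZS κ ((Lc : ℤ) • y + toSite v) := by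
      intro κ
      have e := tsum_ite_blk_eq hLc y (fun u => -(1 / 2 : ℝ) * (colH G Lc ν y' κ u * ZS κ u))
      rw [Finset.mul_sum, ← e]
      refine tsum_congr fun u => ?_
      split_ifs <;> ring
    have hM : ∀ ρ' : Fin (d + 1), (∑' w : Site (d + 1), colM G Lc ν y' ρ' w * (-(if w = y then (1 / 2 : ℝ) else 0)) * ZM ρ' w)
        = -(1 / 2 : ℝ) * (colM G Lc ν y' ρ' y * ZM ρ' y) := by
      intro ρ'
      rw [tsum_eq_single y (fun w hw => by rw [if_neg hw, neg_zero, mul_zero, zero_mul])]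
      rw [if_pos rfl]; ring
    simp only [hS, hM]
    have eH : (∑ κ : Fin (d + 1), ∑ v ∈ box (d + 1) Lc,
        (((y' lam : ℤ) : ℝ) - ((y lam : ℤ) : ℝ)) * colH G Lc ν y' κ ((Lc : ℤ) • y + toSite v) * ZS κ ((Lc : ℤ) • y + toSite v))
        = (((y' lam : ℤ) : ℝ) - ((y lam : ℤ) : ℝ)) *
          ∑ κ : Fin (d + 1), ∑ v ∈ box (d + 1) Lc, colH G Lc ν y' κ ((Lc : ℤ) • y + toSite v) * ZS κ ((Lc : ℤ) • y + toSite v) := by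
      rw [Finset.mul_sum]
      refine Finset.sum_congr rfl fun κ _ => ?_
      rw [Finset.mul_sum]
      exact Finset.sum_congr rfl fun v _ => by ring
    have eM : (∑ ρ' : Fin (d + 1), (((y' lam : ℤ) : ℝ) - ((y lam : ℤ) : ℝ)) * colM G Lc ν y' ρ' y * ZM ρ' y)
        = (((y' lam : ℤ) : ℝ) - ((y lam : ℤ) : ℝ)) * ∑ ρ' : Fin (d + 1), colM G Lc ν y' ρ' y * ZM ρ' y := by
      rw [Finset.mul_sum]
      exact Finset.sum_congr rfl fun ρ' _ => by ring
    have eS : (∑ κ : Fin (d + 1), -(1 / 2 : ℝ) * ∑ v ∈ box (d + 1) Lc, colH G Lc ν y' κ ((Lc : ℤ) • y + toSite v) * ZS κ ((Lc : ℤ) • y + toSite v))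
        = -(1 / 2 : ℝ) * ∑ κ : Fin (d + 1), ∑ v ∈ box (d + 1) Lc, colH G Lc ν y' κ ((Lc : ℤ) • y + toSite v) * ZS κ ((Lc : ℤ) • y + toSite v) := by
      rw [Finset.mul_sum]
    have eT : (∑ ρ' : Fin (d + 1), -(1 / 2 : ℝ) * (colM G Lc ν y' ρ' y * ZM ρ' y))
        = -(1 / 2 : ℝ) * ∑ ρ' : Fin (d + 1), colM G Lc ν y' ρ' y * ZM ρ' y := by
      rw [Finset.mul_sum]
    rw [eH, eM]
    simp only [eS, eT]
    ring

end Pointwise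

/-! ## §2 The first slot-moment of an exponentially decaying column is summable -/

section Summable

variable {N : ℕ}

/-- [folklore] A coordinate of a lattice vector is at most its `ℓ¹` norm. -/
theorem abs_coord_sub_le_l1 (y' y : Site (d + 1)) (lam : Fin (d + 1)) :
    |(((y' lam : ℤ) : ℝ) - ((y lam : ℤ) : ℝ))| ≤ l1 (y' - y) := by
  have h : (((y' lam : ℤ) : ℝ) - ((y lam : ℤ) : ℝ)) = (((y' - y) lam : ℤ) : ℝ) := by
    rw [Pi.sub_apply, Int.cast_sub]
  rw [h]
  exact Finset.single_le_sum (f := fun μ => |(((y' - y) μ : ℤ) : ℝ)|) (fun _ _ => abs_nonneg _) (Finset.mem_univ lam)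

/-- [folklore] **THE FIRST SLOT-MOMENT OF A DECAYING COLUMN IS SUMMABLE**: if `|f y′| ≤ C·e^{−δ|u − N•y′|₁}` (`N ≥ 1`, `δ > 0`) then `y′ ↦ (y′ − y)_λ·f y′` is summable
over the coarse lattice (domination by `C·(2∕δ + |u − N•y|₁)·e^{−(δ∕2)|u − N•y′|₁}`). -/
theorem summable_slotMoment_of_decay (hN : 1 ≤ N) {C δ : ℝ} (hδ : 0 < δ) (u y : Site (d + 1)) (lam : Fin (d + 1))
    {f : Site (d + 1) → ℝ} (hf : ∀ y', |f y'| ≤ C * Real.exp (-δ * l1 (u - (N : ℤ) • y'))) :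
    Summable fun y' : Site (d + 1) => (((y' lam : ℤ) : ℝ) - ((y lam : ℤ) : ℝ)) * f y' := by
  have hC : 0 ≤ C := by
    have h := (abs_nonneg _).trans (hf y)
    exact nonneg_of_mul_nonneg_left h (Real.exp_pos _)
  refine Summable.of_norm_bounded (((summable_exp_coarse' (d := d) hN (half_pos hδ) u).mul_left
    (C * (2 / δ + l1 (u - (N : ℤ) • y))))) (fun y' => ?_)
  rw [Real.norm_eq_abs, abs_mul]
  -- the slot offset is controlled by the two distances to `u`
  have h1 : |(((y' lam : ℤ) : ℝ) - ((y lam : ℤ) : ℝ))| ≤ l1 (u - (N : ℤ) • y') + l1 (u - (N : ℤ) • y) := by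
    refine (abs_coord_sub_le_l1 y' y lam).trans ?_
    have h2 : l1 (y' - y) ≤ l1 ((N : ℤ) • y' - (N : ℤ) • y) := by
      rw [← smul_sub, l1_natSmul]
      have hN' : (1 : ℝ) ≤ (N : ℝ) := by exact_mod_cast hN
      nlinarith [l1_nonneg (y' - y)]
    have h3 := l1_sub_triangle ((N : ℤ) • y') u ((N : ℤ) • y)
    rw [l1_sub_symm ((N : ℤ) • y') u] at h3
    linarith
  have hA : 0 ≤ l1 (u - (N : ℤ) • y') := l1_nonneg _
  have hB : 0 ≤ l1 (u - (N : ℤ) • y) := l1_nonneg _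
  have h4 : l1 (u - (N : ℤ) • y') * Real.exp (-δ * l1 (u - (N : ℤ) • y')) ≤ 2 / δ * Real.exp (-(δ / 2) * l1 (u - (N : ℤ) • y')) :=
    mul_exp_neg_le hδ _
  have h5 : Real.exp (-δ * l1 (u - (N : ℤ) • y')) ≤ Real.exp (-(δ / 2) * l1 (u - (N : ℤ) • y')) :=
    Real.exp_le_exp.2 (by nlinarith)
  calc |(((y' lam : ℤ) : ℝ) - ((y lam : ℤ) : ℝ))| * |f y'|
      ≤ (l1 (u - (N : ℤ) • y') + l1 (u - (N : ℤ) • y)) * (C * Real.exp (-δ * l1 (u - (N : ℤ) • y'))) :=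
        mul_le_mul h1 (hf y') (abs_nonneg _) (by positivity)
    _ = C * (l1 (u - (N : ℤ) • y') * Real.exp (-δ * l1 (u - (N : ℤ) • y'))
          + l1 (u - (N : ℤ) • y) * Real.exp (-δ * l1 (u - (N : ℤ) • y'))) := by ring
    _ ≤ C * (2 / δ * Real.exp (-(δ / 2) * l1 (u - (N : ℤ) • y'))
          + l1 (u - (N : ℤ) • y) * Real.exp (-(δ / 2) * l1 (u - (N : ℤ) • y'))) := by
        gcongr
    _ = C * (2 / δ + l1 (u - (N : ℤ) • y)) * Real.exp (-(δ / 2) * l1 (u - (N : ℤ) • y')) := by ring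

/-- [folklore] The first slot-moment of the field rows of a coarse column of a decaying kernel is summable over the slot. -/
theorem summable_slotMoment_colH (hN : 1 ≤ N) {K : MKer (d + 1) (Fib d)} {C δ : ℝ} (hK : Decays K C δ) (hδ : 0 < δ)
    (ν : Fin (d + 1)) (κ : Fin (d + 1)) (u y : Site (d + 1)) (lam : Fin (d + 1)) :
    Summable fun y' : Site (d + 1) => (((y' lam : ℤ) : ℝ) - ((y lam : ℤ) : ℝ)) * colH K N ν y' κ u :=
  summable_slotMoment_of_decay hN hδ u y lam fun y' => abs_colH_le (N := N) hK ν y' κ u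

/-- [folklore] The first slot-moment of the multiplier rows of a coarse column of a decaying kernel is summable over the slot. -/
theorem summable_slotMoment_colM (hN : 1 ≤ N) {K : MKer (d + 1) (Fib d)} {C δ : ℝ} (hK : Decays K C δ) (hδ : 0 < δ)
    (ν : Fin (d + 1)) (ρ' : Fin (d + 1)) (w y : Site (d + 1)) (lam : Fin (d + 1)) :
    Summable fun y' : Site (d + 1) => (((y' lam : ℤ) : ℝ) - ((y lam : ℤ) : ℝ)) * colM K N ν y' ρ' w :=
  summable_slotMoment_of_decay hN hδ ((N : ℤ) • w) y lam fun y' => abs_colM_le (N := N) hK ν y' ρ' w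

end Summable

/-! ## §3 The slot-dipole of (α) about the label block, in closed form -/

section Comb

variable {Lc : ℕ} [NeZero Lc]

/-- NOT IN PRINT; OUR BOOKKEEPING (the OWNER gan24-p1 g26's W15 ask; idea-1 g35's (4.9) `π^{RV}` with the label kept).  **THE SLOT-DIPOLE OF (α) IN CLOSED FORM.**
For `G_{j+1} = coDressKBmAt ρ Lc (KInvStep Lc (j+1))`, `S = SpureRecAt … (j+1)`, `M = M1At … (j+1)`, the block generator `X_y` of an in-block root, every slot direction `ν`,
moment direction `λ`, channel `(a,b)`: the first moment over the slot `y′` of the live charge of (α) (the value of `WardResidualRotatedVertex.hasSum_prod_rotatedVertex_comb`) is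
`−¼·[Σ_κ Σ_{v∈box} (Σ'_{y′} (y′−y)_λ·colH G_{j+1} Lc ν y′ κ (Lc•y+v))·Σ'_{(x,z)} S κ (Lc•y+v) x z a b + Σ_ρ′ (Σ'_{y′} (y′−y)_λ·colM G_{j+1} Lc ν y′ ρ′ y)·Σ'_{(x,z)} M ρ′ y x z a b]`
— the FIRST MOMENT OF ONE COARSE COLUMN of `G_{j+1}` against the first-order letters' own pair charges on the label block.  No value asserted. -/
theorem hasSum_slotMoment_rotatedVertex_comb (hLc : 1 ≤ Lc) {r : Fin (d + 1) → ℕ} (hr : r ∈ box (d + 1) Lc) (cE cVH cΛ : ℝ) (j : ℕ)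
    (y : Fin (d + 1) → ℤ) (ν lam : Fin (d + 1)) (a b : Fib d) :
    HasSum (fun y' : Site (d + 1) =>
        (((y' lam : ℤ) : ℝ) - ((y lam : ℤ) : ℝ)) *
          ((1 / 2 : ℝ) *
            ((∑ κ : Fin (d + 1), ∑' u : Site (d + 1),
                colH (coDressKBmAt (toSite r) Lc (KInvStep (d := d) Lc (j + 1))) Lc ν y' κ u
                  * ((if y' = y then (1 / 2 : ℝ) else 0) - (if blk Lc u = y then (1 / 2 : ℝ) else 0))
                  * ∑' xz : Site (d + 1) × Site (d + 1), SpureRecAt d Lc (toSite r) cE cVH cΛ (j + 1) κ u xz.1 xz.2 a b)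
              + ∑ ρ' : Fin (d + 1), ∑' w : Site (d + 1),
                colM (coDressKBmAt (toSite r) Lc (KInvStep (d := d) Lc (j + 1))) Lc ν y' ρ' w
                  * ((if y' = y then (1 / 2 : ℝ) else 0) - (if w = y then (1 / 2 : ℝ) else 0))
                  * ∑' xz : Site (d + 1) × Site (d + 1), M1At d Lc (toSite r) cΛ (j + 1) ρ' w xz.1 xz.2 a b)))
      (-(1 / 4 : ℝ) *
        ((∑ κ : Fin (d + 1), ∑ v ∈ box (d + 1) Lc,
            (∑' y' : Site (d + 1), (((y' lam : ℤ) : ℝ) - ((y lam : ℤ) : ℝ)) *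
                colH (coDressKBmAt (toSite r) Lc (KInvStep (d := d) Lc (j + 1))) Lc ν y' κ ((Lc : ℤ) • y + toSite v))
              * ∑' xz : Site (d + 1) × Site (d + 1), SpureRecAt d Lc (toSite r) cE cVH cΛ (j + 1) κ ((Lc : ℤ) • y + toSite v) xz.1 xz.2 a b)
          + ∑ ρ' : Fin (d + 1),
            (∑' y' : Site (d + 1), (((y' lam : ℤ) : ℝ) - ((y lam : ℤ) : ℝ)) *
                colM (coDressKBmAt (toSite r) Lc (KInvStep (d := d) Lc (j + 1))) Lc ν y' ρ' y)
              * ∑' xz : Site (d + 1) × Site (d + 1), M1At d Lc (toSite r) cΛ (j + 1) ρ' y xz.1 xz.2 a b)) := by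
  obtain ⟨δG, CG, hδG, hCG, hG⟩ := decays_coDressKBmAt_KInvStep (d := d) hr (j + 1)
  set G := coDressKBmAt (toSite r) Lc (KInvStep (d := d) Lc (j + 1)) with hGdef
  -- the summable pieces: first slot-moments of ONE coarse column, times the (slot-free) pair charges
  have hH : ∀ (κ : Fin (d + 1)) (v : Fin (d + 1) → ℕ), HasSum (fun y' : Site (d + 1) =>
      (((y' lam : ℤ) : ℝ) - ((y lam : ℤ) : ℝ)) * colH G Lc ν y' κ ((Lc : ℤ) • y + toSite v)
        * ∑' xz : Site (d + 1) × Site (d + 1), SpureRecAt d Lc (toSite r) cE cVH cΛ (j + 1) κ ((Lc : ℤ) • y + toSite v) xz.1 xz.2 a b)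
      ((∑' y' : Site (d + 1), (((y' lam : ℤ) : ℝ) - ((y lam : ℤ) : ℝ)) * colH G Lc ν y' κ ((Lc : ℤ) • y + toSite v))
        * ∑' xz : Site (d + 1) × Site (d + 1), SpureRecAt d Lc (toSite r) cE cVH cΛ (j + 1) κ ((Lc : ℤ) • y + toSite v) xz.1 xz.2 a b) :=
    fun κ v => (summable_slotMoment_colH hLc hG hδG ν κ _ y lam).hasSum.mul_right _
  have hMs : ∀ ρ' : Fin (d + 1), HasSum (fun y' : Site (d + 1) =>
      (((y' lam : ℤ) : ℝ) - ((y lam : ℤ) : ℝ)) * colM G Lc ν y' ρ' y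
        * ∑' xz : Site (d + 1) × Site (d + 1), M1At d Lc (toSite r) cΛ (j + 1) ρ' y xz.1 xz.2 a b)
      ((∑' y' : Site (d + 1), (((y' lam : ℤ) : ℝ) - ((y lam : ℤ) : ℝ)) * colM G Lc ν y' ρ' y)
        * ∑' xz : Site (d + 1) × Site (d + 1), M1At d Lc (toSite r) cΛ (j + 1) ρ' y xz.1 xz.2 a b) :=
    fun ρ' => (summable_slotMoment_colM hLc hG hδG ν ρ' y y lam).hasSum.mul_right _
  have h := ((hasSum_sum (s := (Finset.univ : Finset (Fin (d + 1)))) fun κ _ =>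
      hasSum_sum (s := box (d + 1) Lc) fun v _ => hH κ v).add
    (hasSum_sum (s := (Finset.univ : Finset (Fin (d + 1)))) fun ρ' _ => hMs ρ')).mul_left (-(1 / 4 : ℝ))
  refine h.congr_fun fun y' => ?_
  exact slotMoment_term_eq hLc G
    (fun κ u => ∑' xz : Site (d + 1) × Site (d + 1), SpureRecAt d Lc (toSite r) cE cVH cΛ (j + 1) κ u xz.1 xz.2 a b)
    (fun ρ' w => ∑' xz : Site (d + 1) × Site (d + 1), M1At d Lc (toSite r) cΛ (j + 1) ρ' w xz.1 xz.2 a b) y ν lam y'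

end Comb

end Summit.QuantumFields.BalabanUV.Beta.GAN24.WardResidualRotatedVertexDipole

end
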